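import Summits.Ventures.HodgeRepro2.T5FiniteMultiplicity
import Summits.Ventures.HodgeRepro2.T5AutomorphizeKernel
import Summits.Ventures.HodgeRepro2.T5RegularRep

/-!
# T5QuotientDecomposition — [DE] Theorem 9.2.2 for `L²(G ⧸ Γ)`, modulo ONE identity

Cell pub-hodge-repro2, seat p5, Tier 5 (route/T5-N4-p5.md, N4.3 v13 (B1)–(B2)).  Rows 36 and
48–56 hold every piece of [DE] Theorem 9.2.2 («`L²(Γ\G)` decomposes discretely with finite
multiplicities for a cocompact lattice `Γ`») except one: the identity of [DE] Lemma 9.2.3 that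
`η(f)` on `L²` of the quotient IS the integral operator of the kernel `Σ_γ f(x γ⁻¹ y⁻¹)`.  This file
states that identity in the tree's own vocabulary and derives the theorem from it:

* `t2Space_quotient`: the quotient `G ⧸ Γ` is Hausdorff for a properly discontinuous `Γ.op`
  (Mathlib's `t2Space_of_properlyDiscontinuousSMul_of_t2Space`);
* `aestronglyMeasurable_regularRep`: the orbit maps `g ↦ ρ(g) v` of row 36's regular
  representation `regularRep ν : G →* (L²(G ⧸ Γ, ν) →L[ℂ] L²(G ⧸ Γ, ν))` are a.e.-strongly
  measurable (strong continuity + second countability of `G`);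
* `KernelIdentity μ ν`: **the one remaining input** — for every `f ∈ C_c(G)` with `f* = f`,
  `etaOpL μ (regularRep ν) … = integralOp ν (kernelCont …)` as continuous linear maps on
  `L²(G ⧸ Γ, ν)` (Mathlib's unfolding trick on the quotient measure of a fundamental domain plus the
  interchange of the `L²`-valued Bochner integral with a.e. evaluation — prose [C] in N4.3);
* `isCompactOperator_etaOpL_regularRep`: under the identity, every such `η(f)` is a compact
  operator (row 56);
* `exists_decomposition_regularRep`: **[DE] Theorem 9.2.2 for `L²(G ⧸ Γ, ν)`** — under the
  identity, `L²(G ⧸ Γ, ν)` is the closed orthogonal sum of irreducible closed `G`-stable subspaces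
  in which every unitary-equivalence class is FINITE (row 53).

Conventions: Mathlib's left cosets `G ⧸ Γ` with the LEFT action of `G`, `ν` a finite
`G`-invariant Borel measure on the compact quotient (the quotient of a Haar measure along a
fundamental domain), `μ` a Haar measure on `G` (open-positive, finite on compacts, inversion
invariant — `G` unimodular), `Γ.op` properly discontinuous (a discrete `Γ`, row 55).  Mathlib only
besides rows 36, 53, 56.  Axioms: propext, Classical.choice, Quot.sound.  README §8(d): uses an
L-value-free non-vanishing device: NO.
-/

namespace Summit.Ventures.HodgeRepro2.T5QuotientDecomposition

open MeasureTheory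
open Summit.Ventures.HodgeRepro2.T5ConvolutionAdjoint
open Summit.Ventures.HodgeRepro2.T5FiniteMultiplicity
open Summit.Ventures.HodgeRepro2.T5KernelOperatorCompact
open Summit.Ventures.HodgeRepro2.T5AutomorphizeKernel
open Summit.Ventures.HodgeRepro2.T5RegularRep
open Summit.Ventures.HodgeRepro2.T5CompactDiscreteDecomposition (IrreducibleOn)

variable {G : Type*} [Group G] [TopologicalSpace G] [IsTopologicalGroup G] [LocallyCompactSpace G]
  [MeasurableSpace G] [BorelSpace G] [SecondCountableTopology G] (μ : Measure G)
  {Γ : Subgroup G} [MeasurableSpace (G ⧸ Γ)] [BorelSpace (G ⧸ Γ)] [R1Space (G ⧸ Γ)]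
  (ν : Measure (G ⧸ Γ)) [IsFiniteMeasure ν] [SMulInvariantMeasure G (G ⧸ Γ) ν]
  [ν.InnerRegularCompactLTTop]

omit [MeasurableSpace G] [BorelSpace G] [SecondCountableTopology G] [MeasurableSpace (G ⧸ Γ)]
  [BorelSpace (G ⧸ Γ)] [R1Space (G ⧸ Γ)] in
/-- The quotient of a Hausdorff locally compact group by a subgroup whose `Γ.op` acts properly
discontinuously (a discrete subgroup, row 55) is Hausdorff — the `R1Space (G ⧸ Γ)` hypothesis
below. -/
theorem t2Space_quotient [T2Space G] [ProperlyDiscontinuousSMul Γ.op G] : T2Space (G ⧸ Γ) :=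
  t2Space_of_properlyDiscontinuousSMul_of_t2Space (Γ := Γ.op) (T := G)

/-- The orbit maps `g ↦ ρ(g) v` of the regular representation on `L²(G ⧸ Γ, ν)` are a.e.-strongly
measurable for `μ` (strong continuity, row 36, and second countability of `G`). -/
theorem aestronglyMeasurable_regularRep (v : Lp ℂ 2 ν) :
    AEStronglyMeasurable (fun g : G => regularRep (G := G) ν g v) μ :=
  (continuous_regularRep_apply ν v).aestronglyMeasurable

/-- **The one remaining input of [DE] Theorem 9.2.2 ([DE] Lemma 9.2.3, the identity — A. Deitmar,
S. Echterhoff, Principles of Harmonic Analysis, 2nd ed., Springer 2014, §9.2 p0235):** for every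
`f ∈ C_c(G)` with `f* = f`, the operator `η(f) = ∫ f(g) ρ(g) dg` on `L²(G ⧸ Γ, ν)` is the integral
operator of the continuous kernel `Σ_γ f(x γ⁻¹ y⁻¹)` of row 56. -/
def KernelIdentity [ProperlyDiscontinuousSMul Γ.op G] [CompactSpace (G ⧸ Γ)]
    [WeaklyLocallyCompactSpace G] : Prop :=
  ∀ (f : G → ℂ) (hf : Integrable f μ) (hfc : Continuous f) (hfs : HasCompactSupport f),
    starFun f = f →
      etaOpL μ (regularRep (G := G) ν) (star_regularRep (G := G) ν) hf
        (aestronglyMeasurable_regularRep μ ν) = integralOp ν (kernelCont hfc hfs)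

/-- Under the kernel identity every `η(f)`, `f ∈ C_c(G)`, `f* = f`, is a COMPACT operator on
`L²(G ⧸ Γ, ν)` (row 56: continuous kernels on the compact quotient). -/
theorem isCompactOperator_etaOpL_regularRep [ProperlyDiscontinuousSMul Γ.op G]
    [CompactSpace (G ⧸ Γ)] [WeaklyLocallyCompactSpace G] (hid : KernelIdentity μ ν) (f : G → ℂ)
    (hf : Integrable f μ) (hfc : Continuous f) (hfs : HasCompactSupport f) (hstar : starFun f = f) :
    IsCompactOperator (etaOpL μ (regularRep (G := G) ν) (star_regularRep (G := G) ν) hf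
      (aestronglyMeasurable_regularRep μ ν)) := by
  rw [hid f hf hfc hfs hstar]
  exact isCompactOperator_integralOp_kernelCont ν hfc hfs

/-- **[DE] Theorem 9.2.2 for `L²(G ⧸ Γ, ν)`, modulo the kernel identity.** For a Haar measure `μ`
on `G` (open-positive, finite on compacts, inversion invariant) and a finite `G`-invariant Borel
measure `ν` on the compact quotient `G ⧸ Γ`, `Γ.op` properly discontinuous: `L²(G ⧸ Γ, ν)` is the
closed orthogonal sum of a family of irreducible closed `G`-stable subspaces in which every
unitary-equivalence class is finite. -/
theorem exists_decomposition_regularRep [μ.IsOpenPosMeasure] [IsFiniteMeasureOnCompacts μ]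
    [μ.IsInvInvariant] [ProperlyDiscontinuousSMul Γ.op G] [CompactSpace (G ⧸ Γ)]
    (hid : KernelIdentity μ ν) :
    ∃ S : Set (Submodule ℂ (Lp ℂ 2 ν)), (∀ U ∈ S, IrreducibleOn (regularRep (G := G) ν) U) ∧
      S.Pairwise (fun U V => U ⟂ V) ∧ (sSup S).topologicalClosure = ⊤ ∧
      ∀ U₀ ∈ S, {U ∈ S | IsUnitaryEquiv (regularRep (G := G) ν) U₀ U}.Finite :=
  exists_decomposition_of_isCompactOperator_etaOpL μ (regularRep (G := G) ν)
    (star_regularRep (G := G) ν) (continuous_regularRep_apply ν)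
    (aestronglyMeasurable_regularRep μ ν)
    fun f hf hfc hfs hstar => isCompactOperator_etaOpL_regularRep μ ν hid f hf hfc hfs hstar

end Summit.Ventures.HodgeRepro2.T5QuotientDecomposition
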